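import Mathlib
import HarnessLib
import Summits.QuantumFields.YangMills.Theorems.ComplexCouplingChannelContinuumLegGivenGapAlternatingArraysDefs
import Summits.QuantumFields.YangMills.Theorems.ComplexCouplingChannelContinuumLegGivenGapArrayFunctionalReflection
import Summits.QuantumFields.YangMills.Theorems.ComplexCouplingChannelContinuumLegGivenGapArrayFunctionalGrid
import Summits.QuantumFields.YangMills.Theorems.ComplexCouplingChannelContinuumLegGivenGapArrayFunctionalRP
import Summits.QuantumFields.YangMills.Theorems.ComplexCouplingChannelContinuumLegGivenGapArrayFunctionalObs
import Literature.Probability.LatticeModels.ChessboardEstimateAssignments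

/-!
# The array functional of the chessboard estimate: unit, means, reflection positivity
# (crux `ContinuumLegGivenGap`, stmt-QuantumFields-15828, line `alternating-curvature-arrays`, helper of
# `stub_arrayFunctional`)

The Wilson reflection-positivity INSTANCE behind the chessboard estimate on the odd torus `2L+1` with the alternating
grid of `N = numCells L m` cells per axis (`3^m N = 2 (2L+1)`, `N` even): for `n` smeared plaquette fields with home
cells `z i`, orientations `q i`, real test functions `f i`, the block `c : BlockIdx 4 N = (ℤ/N)^4` of the block torus
carries, under the label `some i`, the mirror copy `arrayObs … (z i) (blockRep c) (q i) (f i)` (representative cell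
index `blockRep c = (c_μ.val)_μ`) and, under the label `none`, the unit (`blockObs`); the ARRAY FUNCTIONAL of a label
assignment `σ` is `arrayPsi σ = ∫ ∏_c blockObs (σ c) c dμ_β` (`wilsonMeasure` at `β` on the torus of side `2L+1`).
Proved here: `arrayPsi (const none) = 1` (`arrayPsi_const_none`); `arrayPsi (const (some i)) = arrayMean (f i)`
(`arrayPsi_const_some`, reindexing `BlockIdx 4 N ≃ cellIndices L m`); and, for `β ≥ 0` and test functions supported in
the cores of their home cells, REFLECTION POSITIVITY with the reflection Cauchy–Schwarz inequality for every axis `μ`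
and block boundary `c₀` (`arrayPsi_rp`): with `H₊ = halfPlus N μ c₀`, `F = ∏_{b ∈ H₊} blockObs (σ b) b`,
`G = ∏_{b ∈ H₊} blockObs (σ (θ b)) b` and the lattice wall reflection `Θ = configReflect μ (2v_μ + 3^m c₀.val)`
(`…ArrayFunctionalReflection`), the covariance `blockObs a (θ b) (Θ U) = blockObs a b U` (`…ArrayFunctionalObs`)
gives `arrayPsi σ = ⟨G∘Θ · F⟩`, `arrayPsi (asgSymP μ c₀ σ) = ⟨F∘Θ · F⟩`, `arrayPsi (asgSymM μ c₀ σ) = ⟨G∘Θ · G⟩`,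
and `…ArrayFunctionalRP.wall_rp_cauchySchwarz` applies because core-supported copies in cells of `H₊` live strictly
inside the open positive half-slab of the wall (`…ArrayFunctionalObs.exists_lift_of_mem_arrayObs_support`).
References: J. Fröhlich, R. Israel, E. H. Lieb, B. Simon, Comm. Math. Phys. 62 (1978) 1, §2 and Thm. 2.2. [folklore]
-/

set_option autoImplicit false

noncomputable section

namespace Summit.QuantumFields.YangMills.Theorems.ContinuumLegGivenGap

open scoped SchwartzMap
open MeasureTheory
open Literature.MathematicalPhysics.QuantumFieldTheory Literature.MathematicalPhysics.QuantumLattice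
open Literature.Probability.LatticeModels (Torus.proj box asgSymP asgSymM asgSymP_apply_of_mem asgSymP_apply_of_not_mem
  asgSymM_apply_of_mem asgSymM_apply_of_not_mem not_mem_halfMinus_of_mem_halfPlus)
open Literature.Barriers.CriticalPhenomena.NonGibbs (BlockIdx cellReflect halfPlus halfMinus mem_halfPlus mem_halfMinus
  cellReflect_apply cellReflect_cellReflect disjoint_halfPlus_halfMinus mem_halfPlus_or_mem_halfMinus
  cellReflect_mem_halfMinus cellReflect_mem_halfPlus)
open Summit.QuantumFields.YangMills.Theorems.ContinuumLegGivenGap.AlternatingArrays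
open Summit.QuantumFields.YangMills.Cruxes.ContinuumLimitOnTrajectory.TwoOrbitSynchronisation (PlaqIdx)

variable {G : Type} [Group G] [TopologicalSpace G] [IsTopologicalGroup G] [CompactSpace G]
  [MeasurableSpace G] [BorelSpace G]

/-! ## Blocks, block observables, the array functional -/

omit [Group G] [TopologicalSpace G] [IsTopologicalGroup G] [CompactSpace G] [MeasurableSpace G] [BorelSpace G] in
/-- The representative cell index of a block: `(c_μ.val)_μ ∈ {0, …, N-1}^4`. [folklore] -/
def blockRep {N : ℕ} (c : BlockIdx 4 N) : Fin 4 → ℤ := fun μ => ((c μ).val : ℤ)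

/-- **The observable carried by the block `c` under the label `a`**: the unit for `none`, the mirror copy in the cell
`blockRep c` of the `i`-th smeared plaquette field for `some i`. [folklore] -/
def blockObs (r : LatticeRep G) (βv a : ℝ) (L m : ℕ) (v : Fin 4 → ℤ) {n : ℕ} (z : Fin n → Fin 4 → ℤ)
    (q : Fin n → PlaqIdx) (f : Fin n → 𝓢(EuclideanSpace ℝ (Fin 4), ℝ)) {N : ℕ} (lab : Option (Fin n))
    (c : BlockIdx 4 N) (U : GaugeConfig 4 (2 * L + 1) G) : ℝ :=
  lab.elim 1 fun i => arrayObs r βv a L m v (z i) (blockRep c) (q i) (f i) U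

/-- **The array functional** of a label assignment: the Wilson expectation of the product over all blocks of the
observables they carry. [folklore] -/
def arrayPsi (r : LatticeRep G) (βv a : ℝ) (L m : ℕ) (v : Fin 4 → ℤ) {n : ℕ} (z : Fin n → Fin 4 → ℤ)
    (q : Fin n → PlaqIdx) (f : Fin n → 𝓢(EuclideanSpace ℝ (Fin 4), ℝ)) {N : ℕ} [NeZero N]
    (σ : BlockIdx 4 N → Option (Fin n)) : ℝ :=
  ∫ U, ∏ c, blockObs r βv a L m v z q f (σ c) c U ∂(wilsonMeasure (d := 4) (L := 2 * L + 1) r.ρ βv)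

section Basic

variable (r : LatticeRep G) (βv a : ℝ) (L m : ℕ) (v : Fin 4 → ℤ) {n : ℕ} (z : Fin n → Fin 4 → ℤ)
  (q : Fin n → PlaqIdx) (f : Fin n → 𝓢(EuclideanSpace ℝ (Fin 4), ℝ))

/-- The unit label carries the unit. [folklore] -/
@[simp] theorem blockObs_none {N : ℕ} (c : BlockIdx 4 N) (U : GaugeConfig 4 (2 * L + 1) G) :
    blockObs r βv a L m v z q f none c U = 1 := rfl

/-- The label `some i` carries the mirror copy of the `i`-th field. [folklore] -/
@[simp] theorem blockObs_some {N : ℕ} (i : Fin n) (c : BlockIdx 4 N) (U : GaugeConfig 4 (2 * L + 1) G) :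
    blockObs r βv a L m v z q f (some i) c U = arrayObs r βv a L m v (z i) (blockRep c) (q i) (f i) U := rfl

/-- Block observables are continuous. [folklore] -/
theorem continuous_blockObs {N : ℕ} (lab : Option (Fin n)) (c : BlockIdx 4 N) :
    Continuous (blockObs r βv a L m v z q f lab c) := by
  cases lab with
  | none => exact continuous_const
  | some i => exact continuous_arrayObs r βv a L m v (z i) (blockRep c) (q i) (f i)

/-- **(UNIT)** the empty assignment has functional `1`. [folklore] -/
theorem arrayPsi_const_none {N : ℕ} [NeZero N] :
    arrayPsi r βv a L m v z q f (fun _ : BlockIdx 4 N => none) = 1 := by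
  haveI := isProbabilityMeasure_wilsonMeasure (d := 4) (L := 2 * L + 1) r.ρ r.continuous βv
  simp [arrayPsi]

/-- **(MEAN)** the constant assignment `some i` has functional `arrayMean (f i)`: the blocks are re-indexed by the
cell indices `{0, …, N-1}^4` (`N = numCells L m`). [folklore] -/
theorem arrayPsi_const_some {N : ℕ} [NeZero N] (hNc : numCells L m = N) (i : Fin n) :
    arrayPsi r βv a L m v z q f (fun _ : BlockIdx 4 N => some i) = arrayMean r βv a L m v (z i) (q i) (f i) := by
  unfold arrayPsi arrayMean
  refine integral_congr_ae (ae_of_all _ fun U => ?_)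
  simp only [blockObs_some]
  refine Finset.prod_nbij' blockRep (fun z' μ => ((z' μ : ℤ) : ZMod N)) (fun c _ => ?_) (fun _ _ => Finset.mem_univ _)
    (fun c _ => ?_) (fun z' hz' => ?_) (fun _ _ => rfl)
  · simp only [cellIndices, Fintype.mem_piFinset, Finset.mem_image, Finset.mem_range, hNc]
    exact fun μ => ⟨(c μ).val, ZMod.val_lt _, rfl⟩
  · funext μ; simp [blockRep]
  · simp only [cellIndices, Fintype.mem_piFinset, Finset.mem_image, Finset.mem_range, hNc] at hz'
    funext μ
    obtain ⟨k, hk, hkμ⟩ := hz' μ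
    simp only [blockRep, ← hkμ, Int.cast_natCast, ZMod.val_natCast, Nat.mod_eq_of_lt hk]

end Basic

/-! ## Reflection covariance and support of the block observables -/

section Covariance

variable (r : LatticeRep G) (βv a : ℝ) {L m N : ℕ} [NeZero N] (hPN : (3 : ℤ) ^ m * N = 2 * ((2 * L + 1 : ℕ) : ℤ))
  (hN : Even N) (v : Fin 4 → ℤ) {n : ℕ} (z : Fin n → Fin 4 → ℤ) (q : Fin n → PlaqIdx)
  (f : Fin n → 𝓢(EuclideanSpace ℝ (Fin 4), ℝ))

include hPN hN in
/-- **Covariance of the block observables**: the observable of the reflected block read on the configuration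
reflected through the lattice wall `v_μ + 3^m c₀.val / 2` is the observable of the block. [folklore] -/
theorem blockObs_cellReflect_configReflect (μ : Fin 4) (c₀ : ZMod N) (lab : Option (Fin n)) (b : BlockIdx 4 N)
    (U : GaugeConfig 4 (2 * L + 1) G) :
    blockObs r βv a L m v z q f lab (cellReflect μ c₀ b)
        (configReflect μ ((2 * v μ + 3 ^ m * (c₀.val : ℤ) : ℤ) : ZMod (2 * L + 1)) U) =
      blockObs r βv a L m v z q f lab b U := by
  cases lab with
  | none => rfl
  | some i =>
    simp only [blockObs_some]
    refine arrayObs_configReflect r βv a hPN hN v (z i) (q i) (f i) μ (c₀.val : ℤ) ?_ (fun ν hν => ?_) U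
    · rw [← ZMod.intCast_zmod_eq_zero_iff_dvd]
      simp only [blockRep, cellReflect_apply, Function.update_self]
      push_cast
      rw [ZMod.natCast_zmod_val, ZMod.natCast_zmod_val, ZMod.natCast_zmod_val]
      ring
    · simp [blockRep, hν]

include hPN hN in
/-- The same covariance with the reflection moved to the block: `blockObs a b (Θ U) = blockObs a (θ b) U`.
[folklore] -/
theorem blockObs_configReflect (μ : Fin 4) (c₀ : ZMod N) (lab : Option (Fin n)) (b : BlockIdx 4 N)
    (U : GaugeConfig 4 (2 * L + 1) G) :
    blockObs r βv a L m v z q f lab b (configReflect μ ((2 * v μ + 3 ^ m * (c₀.val : ℤ) : ℤ) : ZMod (2 * L + 1)) U) =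
      blockObs r βv a L m v z q f lab (cellReflect μ c₀ b) U := by
  have h := blockObs_cellReflect_configReflect r βv a hPN hN v z q f μ c₀ lab (cellReflect μ c₀ b) U
  rwa [cellReflect_cellReflect] at h

include hPN hN in
/-- **Support**: for `a > 0`, `f i` supported in the core of its home cell and `b` in the positive half of the block
torus for the boundary `c₀` in the axis `μ`, the block observable depends only on links strictly inside the open
positive half-slab of the lattice wall `A/2`, `A = 2v_μ + 3^m c₀.val`. [folklore] -/
theorem dependsOn_blockObs_posSlab (ha : 0 < a) (hf : ∀ i, tsupport (f i) ⊆ physCore a m v (z i)) (μ : Fin 4)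
    (c₀ : ZMod N) (lab : Option (Fin n)) {b : BlockIdx 4 N} (hb : b ∈ halfPlus N μ c₀) :
    DependsOn (blockObs r βv a L m v z q f lab b)
      (posSlabEdges (2 * L + 1) μ (2 * v μ + 3 ^ m * (c₀.val : ℤ))) := by
  cases lab with
  | none => exact fun _ _ _ => rfl
  | some i =>
    show DependsOn (arrayObs r βv a L m v (z i) (blockRep b) (q i) (f i)) _
    refine (dependsOn_arrayObs r βv a L m v (z i) (blockRep b) (q i) (f i)).mono fun e he => ?_
    rw [mem_posSlabEdges]
    rw [mem_halfPlus] at hb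
    obtain ⟨u, hu⟩ := hN
    refine exists_lift_of_mem_arrayObs_support hPN ha v (z i) (q i) (hf i) μ (b := blockRep b) (B := (b μ).val)
      (c := c₀.val) (w := (b μ - c₀).val) rfl (by omega) ?_ he
    rw [← ZMod.intCast_zmod_eq_zero_iff_dvd]
    push_cast
    rw [ZMod.natCast_zmod_val, ZMod.natCast_zmod_val, ZMod.natCast_zmod_val]
    ring

end Covariance

/-! ## Reflection positivity of the array functional -/

section RP

variable (r : LatticeRep G) {βv a : ℝ} {L m N : ℕ} [NeZero N] (hPN : (3 : ℤ) ^ m * N = 2 * ((2 * L + 1 : ℕ) : ℤ))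
  (hN : Even N) (hL : 1 ≤ L) (hβ : 0 ≤ βv) (ha : 0 < a) (v : Fin 4 → ℤ) {n : ℕ} {z : Fin n → Fin 4 → ℤ}
  (q : Fin n → PlaqIdx) {f : Fin n → 𝓢(EuclideanSpace ℝ (Fin 4), ℝ)}
  (hf : ∀ i, tsupport (f i) ⊆ physCore a m v (z i))

include hPN hN in
/-- The product over the negative half, re-indexed by the block reflection and read through the covariance:
`∏_{b ∈ H₋} blockObs (τ b) b U = ∏_{b ∈ H₊} blockObs (τ (θ b)) b (Θ U)`. [folklore] -/
theorem prod_halfMinus_eq (μ : Fin 4) (c₀ : ZMod N) (τ : BlockIdx 4 N → Option (Fin n))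
    (U : GaugeConfig 4 (2 * L + 1) G) :
    ∏ b ∈ halfMinus N μ c₀, blockObs r βv a L m v z q f (τ b) b U =
      ∏ b ∈ halfPlus N μ c₀, blockObs r βv a L m v z q f (τ (cellReflect μ c₀ b)) b
        (configReflect μ ((2 * v μ + 3 ^ m * (c₀.val : ℤ) : ℤ) : ZMod (2 * L + 1)) U) := by
  symm
  refine Finset.prod_nbij' (cellReflect μ c₀) (cellReflect μ c₀) (fun b hb => cellReflect_mem_halfMinus hN hb)
    (fun b hb => cellReflect_mem_halfPlus hN hb) (fun b _ => cellReflect_cellReflect μ c₀ b)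
    (fun b _ => cellReflect_cellReflect μ c₀ b) (fun b _ => ?_)
  rw [blockObs_configReflect r βv a hPN hN]

/-- The product over all blocks splits over the two halves. [folklore] -/
theorem prod_univ_eq_prod_halfPlus_mul (μ : Fin 4) (c₀ : ZMod N) (g : BlockIdx 4 N → ℝ) :
    ∏ b, g b = (∏ b ∈ halfPlus N μ c₀, g b) * ∏ b ∈ halfMinus N μ c₀, g b := by
  rw [← Finset.prod_union (disjoint_halfPlus_halfMinus μ c₀)]
  refine Finset.prod_congr ?_ fun _ _ => rfl
  exact (Finset.eq_univ_of_forall fun b => Finset.mem_union.2 (mem_halfPlus_or_mem_halfMinus μ c₀ b)).symm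

include hPN hN hL hβ ha hf in
/-- **(RP) Reflection positivity and the reflection Cauchy–Schwarz inequality of the array functional** for every
axis `μ` and block boundary `c₀` (Fröhlich–Israel–Lieb–Simon 1978, proof of Thm. 2.2, on the odd torus with the
alternating site/link walls): `0 ≤ ψ(asgSymP μ c₀ σ)`, `0 ≤ ψ(asgSymM μ c₀ σ)` and
`ψ σ ^ 2 ≤ ψ(asgSymP μ c₀ σ) · ψ(asgSymM μ c₀ σ)`. [folklore] -/
theorem arrayPsi_rp (μ : Fin 4) (c₀ : ZMod N) (σ : BlockIdx 4 N → Option (Fin n)) :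
    0 ≤ arrayPsi r βv a L m v z q f (asgSymP μ c₀ σ) ∧ 0 ≤ arrayPsi r βv a L m v z q f (asgSymM μ c₀ σ) ∧
      arrayPsi r βv a L m v z q f σ ^ 2 ≤
        arrayPsi r βv a L m v z q f (asgSymP μ c₀ σ) * arrayPsi r βv a L m v z q f (asgSymM μ c₀ σ) := by
  haveI : SecondCountableTopology G :=
    (r.continuous.isClosedEmbedding r.injective).isEmbedding.secondCountableTopology
  set A : ℤ := 2 * v μ + 3 ^ m * (c₀.val : ℤ) with hA
  set Θ : GaugeConfig 4 (2 * L + 1) G → GaugeConfig 4 (2 * L + 1) G :=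
    configReflect μ ((A : ℤ) : ZMod (2 * L + 1)) with hΘ
  set F : GaugeConfig 4 (2 * L + 1) G → ℝ := fun U => ∏ b ∈ halfPlus N μ c₀, blockObs r βv a L m v z q f (σ b) b U
    with hF
  set G' : GaugeConfig 4 (2 * L + 1) G → ℝ :=
    fun U => ∏ b ∈ halfPlus N μ c₀, blockObs r βv a L m v z q f (σ (cellReflect μ c₀ b)) b U with hG'
  have hθnot : ∀ {b : BlockIdx 4 N}, b ∈ halfPlus N μ c₀ → cellReflect μ c₀ b ∉ halfPlus N μ c₀ := fun hb h =>
    Finset.disjoint_left.1 (disjoint_halfPlus_halfMinus μ c₀) h (cellReflect_mem_halfMinus hN hb)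
  -- the three functionals as reflection pairings
  have h1 : arrayPsi r βv a L m v z q f σ = ∫ U, G' (Θ U) * F U ∂(wilsonMeasure r.ρ βv) := by
    unfold arrayPsi
    refine integral_congr_ae (ae_of_all _ fun U => ?_)
    beta_reduce
    rw [prod_univ_eq_prod_halfPlus_mul μ c₀, prod_halfMinus_eq r hPN hN v q μ c₀ σ U, mul_comm]
  have h2 : arrayPsi r βv a L m v z q f (asgSymP μ c₀ σ) = ∫ U, F (Θ U) * F U ∂(wilsonMeasure r.ρ βv) := by
    unfold arrayPsi
    refine integral_congr_ae (ae_of_all _ fun U => ?_)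
    beta_reduce
    rw [prod_univ_eq_prod_halfPlus_mul μ c₀, prod_halfMinus_eq r hPN hN v q μ c₀ _ U, mul_comm]
    congr 1
    · exact Finset.prod_congr rfl fun b hb => by
        rw [asgSymP_apply_of_not_mem σ (hθnot hb), cellReflect_cellReflect]
    · exact Finset.prod_congr rfl fun b hb => by rw [asgSymP_apply_of_mem σ hb]
  have h3 : arrayPsi r βv a L m v z q f (asgSymM μ c₀ σ) = ∫ U, G' (Θ U) * G' U ∂(wilsonMeasure r.ρ βv) := by
    unfold arrayPsi
    refine integral_congr_ae (ae_of_all _ fun U => ?_)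
    beta_reduce
    rw [prod_univ_eq_prod_halfPlus_mul μ c₀, prod_halfMinus_eq r hPN hN v q μ c₀ _ U, mul_comm]
    congr 1
    · exact Finset.prod_congr rfl fun b hb => by
        rw [asgSymM_apply_of_mem σ (cellReflect_mem_halfMinus hN hb)]
    · exact Finset.prod_congr rfl fun b hb => by
        rw [asgSymM_apply_of_not_mem σ (not_mem_halfMinus_of_mem_halfPlus hb)]
  -- reflection positivity of Wilson's measure for the wall reflection `Θ`
  have hS : Odd (2 * L + 1) := ⟨L, rfl⟩
  have hFc : Continuous F := continuous_finsetProd _ fun b _ => continuous_blockObs r βv a L m v z q f _ _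
  have hGc : Continuous G' := continuous_finsetProd _ fun b _ => continuous_blockObs r βv a L m v z q f _ _
  have hFd : DependsOn F (posSlabEdges (2 * L + 1) μ A) := fun U V h =>
    Finset.prod_congr rfl fun b hb => dependsOn_blockObs_posSlab r βv a hPN hN v z q f ha hf μ c₀ _ hb h
  have hGd : DependsOn G' (posSlabEdges (2 * L + 1) μ A) := fun U V h =>
    Finset.prod_congr rfl fun b hb => dependsOn_blockObs_posSlab r βv a hPN hN v z q f ha hf μ c₀ _ hb h
  obtain ⟨hGG, hFF, hcs⟩ :=
    wall_rp_cauchySchwarz (d := 4) r.ρ hS (by omega) r.continuous hβ μ A hGc hFc hGd hFd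
  rw [h1, h2, h3]
  exact ⟨hFF, hGG, hcs.trans_eq (mul_comm _ _)⟩

end RP

/-- Anchor of this helper file (registered sub-goal of stmt-QuantumFields-15828, helper of `stub_arrayFunctional`):
the empty assignment has array functional `1`. [folklore] -/
theorem arrayFunctional_anchor_psi :
    ∀ {G : Type} [Group G] [TopologicalSpace G] [IsTopologicalGroup G] [CompactSpace G] [MeasurableSpace G]
      [BorelSpace G] (r : LatticeRep G) (βv a : ℝ) (L m : ℕ) (v : Fin 4 → ℤ) {n : ℕ} (z : Fin n → Fin 4 → ℤ)
      (q : Fin n → PlaqIdx) (f : Fin n → 𝓢(EuclideanSpace ℝ (Fin 4), ℝ)) {N : ℕ} [NeZero N],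
      arrayPsi r βv a L m v z q f (fun _ : BlockIdx 4 N => none) = 1 :=
  by intro G _ _ _ _ _ _ r βv a L m v n z q f N _; exact arrayPsi_const_none r βv a L m v z q f

end Summit.QuantumFields.YangMills.Theorems.ContinuumLegGivenGap

end
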